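import Literature.MathematicalPhysics.KineticTheory.BoltzmannSolutions
import Literature.MathematicalPhysics.KineticTheory.LanfordUniqueness
import Literature.MathematicalPhysics.KineticTheory.LanfordExistence
import Literature.MathematicalPhysics.KineticTheory.BoltzmannSolutionsUkaiExistence
import HarnessLib

/-!
# Proofs for `Literature.MathematicalPhysics.KineticTheory.BoltzmannSolutions`

Companion ("Proofs") file of `BoltzmannSolutions.lean`, discharging named facts stated there.
(Extend by appending a new section to the current tree version — never replace it wholesale.)

## 1. `ukai_lanford_bound_holds` — propagation of the Gaussian bound (hilbert6.S13)

Discharge of `Literature.MathematicalPhysics.KineticTheory.ukai_lanford_bound`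
(Gallagher–Saint-Raymond–Texier 2013, Part I Ch. 2 §3.1 Thm 1; Part II Ch. 5 Thm 7,
Remark 5.1.5; Ukai 1974): for `β₀ > 0`, `K > 0` there are `T = T(d, β₀, K) > 0` and `K' = 2K`
such that EVERY mild solution `f ∈ C([0,T]; X_{β₀/2})` of the hard-sphere Boltzmann equation on
`T^d` with datum `0 ≤ f₀`, `‖f₀‖_{β₀} ≤ K`, obeys `‖f(t)‖_{β₀/2} ≤ K'` on `[0, T]`.

The printed source proves the bound for THE solution constructed in the scale spaces
`β(t) = β₀ - λt` (and uniqueness there); the statement for every solution of the wide class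
`C([0,T]; X_{β₀/2})` follows by combining

* `hardSphere_mild_exists` (`LanfordExistence`): a mild solution `u` with `u(0) = f₀`,
  continuous slices and `|u(t)| ≤ 2K e^{-(β₀/2)|v|²/2}` exists on `[0, T(d, β₀, K)]`
  (Picard iteration in the scale of Gaussian weights, positivity via the sign-corrected
  collision operator);
* `exists_abs_le_of_continuousInLanfordOn` (`LanfordClassBounds`): the given `f` is uniformly
  bounded in `X_{β₀/2}` on the compact interval `[0, T]`;
* `hardSphere_mild_unique` (`LanfordUniqueness`): uniqueness of mild solutions in
  `L^∞([0,T]; X_{β₀/2})` with continuous slices (Ukai's decaying-weight argument on the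
  difference), so `f = u` on `[0, T]`.

## 2. `ukai_lanford_lwp_holds` — local well-posedness in Lanford's class (hilbert6.S13)

Discharge of `Literature.MathematicalPhysics.KineticTheory.ukai_lanford_lwp`
(Gallagher–Saint-Raymond–Texier 2013, Part I Ch. 2 §3.1 Thm 1 — there stated for bounded
cross-sections on `ℝ^d`; for hard spheres the continuity estimate loses a weight `(1 + |v|)` and
the proof is the scale argument of Part II Ch. 5: Thm 7, the continuity estimates and the Lemma
of Ukai; Ukai 2001), by an independent inline decomposition (D-0026) living in the sibling
helper files `BoltzmannSolutionsUkaiVelocity` (velocity-space continuity estimates for `Q`),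
`BoltzmannSolutionsUkaiDuhamel` (Ukai's time-integral estimate in the scale `β(s) = β₁ - λ(s-t₁)`,
an ODE comparison lemma, Lanford-norm API, time continuity in `X_{β'}`) and
`BoltzmannSolutionsUkaiExistence` (Picard iteration, fixed point, a-posteriori positivity,
`UkaiLanford.exists_mildSolution`). This file adds the uniqueness half in the wide class
`C([0,T]; X_{β₀/2}) ∩ {mild}` (`UkaiLanford.eqOn_strip`, `UkaiLanford.eqOn_of_mild`: a uniform
bound on the compact time interval, then the weighted contraction restarted on consecutive
strips of length `τ(M, β₀)`, finitely many by the Archimedean property) and assembles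
`ukai_lanford_lwp_holds`. The fact is proved exactly as stated. (Section 1 above rests on the
parallel development `Lanford*`; the two are logically independent.)

## References

* I. Gallagher, L. Saint-Raymond, B. Texier, *From Newton to Boltzmann: hard spheres and
  short-range potentials*, EMS (2013) = arXiv:1208.5753, Part I Ch. 2 §3.1 Thm 1, Part II
  Ch. 5 (Def. 5.1.4, §5.3, Thm 7, Remark 5.1.5).
* S. Ukai, *On the existence of global solutions of mixed problem for non-linear Boltzmann
  equation*, Proc. Japan Acad. 50 (1974) 179–184.
-/

open MeasureTheory Metric Real Set Filter Topology
open scoped InnerProductSpace ENNReal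
open Literature.Analysis.FluidPDE

namespace Literature.MathematicalPhysics.KineticTheory

noncomputable section

/-! ## 1. Propagation of the Gaussian bound: `ukai_lanford_bound` -/

section UkaiLanfordBound

variable {d : Type*} [Fintype d]

/-- **Discharge of `ukai_lanford_bound`** (hilbert6.S13; Gallagher–Saint-Raymond–Texier 2013,
Part I Ch. 2 §3.1 Thm 1 and Part II Ch. 5 Thm 7 / Remark 5.1.5; Ukai 1974): with
`T = T(d, β₀, K)` from `hardSphere_mild_exists` and `K' = 2K`, every mild hard-sphere solution
`f ∈ C([0,T]; X_{β₀/2})` on the torus with datum `0 ≤ f₀`, `‖f₀‖_{β₀} ≤ K`, satisfies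
`‖f(t)‖_{β₀/2} ≤ 2K` for `t ∈ [0, T]` — by existence of the scale-space solution `u` with this
bound and uniqueness in the wide class (`hardSphere_mild_unique`), `f = u` on `[0, T]`. [cite: GST2013, Part I Ch. 2 §3.1 Thm 1] -/
theorem ukai_lanford_bound_holds : ukai_lanford_bound (d := d) := by
  intro β₀ hβ₀ K hK
  obtain ⟨T, hT, hE⟩ := hardSphere_mild_exists (d := d) hβ₀ hK
  refine ⟨T, hT, 2 * K, fun f₀ hf₀nn hf₀L hf₀K f hfC hfM hf0 t ht => ?_⟩
  -- the datum: continuity and the real Gaussian bound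
  have hf₀c : Continuous (Function.uncurry f₀) := hf₀L.1
  have hf₀b : ∀ x v, |f₀ x v| ≤ K * exp (-(β₀ / 2) * ‖v‖ ^ 2) :=
    abs_le_of_eGaussSupNorm_le hK.le hf₀K
  -- the scale-space solution with the same datum
  obtain ⟨u, hu, hu0, huc, hub⟩ := hE f₀ hf₀nn hf₀c hf₀b
  -- the given solution is uniformly bounded in `X_{β₀/2}` on `[0, T]`
  obtain ⟨Nf, -, hNf⟩ := exists_abs_le_of_continuousInLanfordOn hfC
  -- a common bound
  set N : ℝ := max Nf (2 * K) with hN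
  have hfb : ∀ s ∈ Icc 0 T, ∀ x v, |f s x v| ≤ N * exp (-(β₀ / 2 / 2) * ‖v‖ ^ 2) :=
    fun s hs x v => (hNf s hs x v).trans
      (mul_le_mul_of_nonneg_right (le_max_left _ _) (exp_pos _).le)
  have hub' : ∀ s ∈ Icc 0 T, ∀ x v, |u s x v| ≤ N * exp (-(β₀ / 2 / 2) * ‖v‖ ^ 2) :=
    fun s _ x v => (hub s x v).trans
      (mul_le_mul_of_nonneg_right (le_max_right _ _) (exp_pos _).le)
  have hfc : ∀ s ∈ Icc 0 T, Continuous (Function.uncurry (f s)) := fun s hs => (hfC.1 s hs).1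
  have huc' : ∀ s ∈ Icc 0 T, Continuous (Function.uncurry (u s)) := fun s _ => huc s
  -- uniqueness in the wide class
  have heq : f t = u t :=
    hardSphere_mild_unique (half_pos hβ₀) hfM hu hfc huc' hfb hub' (hf0.trans hu0.symm) t ht
  rw [heq]
  exact eGaussSupNorm_le_of_abs_le fun x v => hub t x v

end UkaiLanfordBound


/-! ## 2. Local well-posedness in Lanford's class: `ukai_lanford_lwp` -/

section UkaiLanfordLWP

open Literature.Analysis.FunctionSpaces.Torus (proj proj_add proj_neg proj_zero continuous_proj)

variable {d : Type*} [Fintype d]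

namespace UkaiLanford

/-- **One strip of the uniqueness argument.** Two mild solutions `f, g` on `[0, T] × T^d` with a
common Gaussian bound `M e^{-β|v|²/2}` on `[0, T]` and continuous velocity slices, which agree on
`[0, t₁]`, agree on `[t₁, t₁ + τ] ∩ [0, T]` as soon as `4 M S I₁ (τ + 2√τ/√(2λ)) ≤ 1/2` with
`λ τ ≤ β/2` (`I₁ = ∫ (1+|u|) e^{-β|u|²/4}`): the weighted bound of `f - g` in the scale
`β - λ(s - t₁)` improves by the factor `1/2` at each step (GST 2013 Part II Ch. 5, uniqueness
part of Thm 7, restarted at `t₁`). [cite: GST2013, Part II Ch. 5 §2 (Thm 7)] -/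
theorem eqOn_strip {f g : ℝ → UnitAddTorus d → EuclideanSpace ℝ d → ℝ} {β M lam τ T t₁ : ℝ}
    (hβ : 0 < β) (hM : 0 ≤ M) (hlam : 0 < lam) (hτ : 0 ≤ τ) (hlamτ : lam * τ ≤ β / 2)
    (ht₁ : t₁ ∈ Icc 0 T)
    (hfc : ∀ t ∈ Icc 0 T, Continuous (Function.uncurry (f t)))
    (hgc : ∀ t ∈ Icc 0 T, Continuous (Function.uncurry (g t)))
    (hfb : ∀ t ∈ Icc 0 T, ∀ x v, |f t x v| ≤ M * exp (-(β / 2) * ‖v‖ ^ 2))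
    (hgb : ∀ t ∈ Icc 0 T, ∀ x v, |g t x v| ≤ M * exp (-(β / 2) * ‖v‖ ^ 2))
    (hfm : Literature.Analysis.FluidPDE.IsMildBoltzmannSolutionOn T
      (Literature.Analysis.FluidPDE.Torus.geometry d) hardSphereKernel f)
    (hgm : Literature.Analysis.FluidPDE.IsMildBoltzmannSolutionOn T
      (Literature.Analysis.FluidPDE.Torus.geometry d) hardSphereKernel g)
    (hagree : ∀ t ∈ Icc 0 T, t ≤ t₁ → f t = g t)
    (hsmall : 4 * M * (sphereMeasure : Measure (sphere (0 : EuclideanSpace ℝ d) 1)).real univ *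
      (∫ u : EuclideanSpace ℝ d, (1 + ‖u‖) * exp (-(β / 2 / 2) * ‖u‖ ^ 2)) *
      (τ + 2 * sqrt τ / sqrt (2 * lam)) ≤ 1 / 2) :
    ∀ t ∈ Icc 0 T, t ≤ t₁ + τ → f t = g t := by
  set S : ℝ := (sphereMeasure : Measure (sphere (0 : EuclideanSpace ℝ d) 1)).real univ with hS
  set I₁ : ℝ := ∫ u : EuclideanSpace ℝ d, (1 + ‖u‖) * exp (-(β / 2 / 2) * ‖u‖ ^ 2) with hI₁
  set ρ : ℝ := τ + 2 * sqrt τ / sqrt (2 * lam) with hρ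
  set θ : ℝ := 4 * M * S * I₁ * ρ with hθdef
  have hS0 : 0 ≤ S := measureReal_nonneg
  have hI0 : 0 ≤ I₁ := integral_one_add_norm_mul_exp_nonneg _
  have hρ0 : 0 ≤ ρ := by positivity
  have hθ0 : 0 ≤ θ := by positivity
  have hθ1 : θ < 1 := by linarith
  -- the collision terms along characteristics, and the Duhamel formulas
  have hchar : ∀ (h : ℝ → UnitAddTorus d → EuclideanSpace ℝ d → ℝ) (x : UnitAddTorus d)
      (v : EuclideanSpace ℝ d), (fun σ =>
        Literature.Analysis.FluidPDE.alongFlow (Literature.Analysis.FluidPDE.Torus.geometry d)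
          (Literature.Analysis.FluidPDE.collisionTerm hardSphereKernel h) σ x v) =
        fun σ => collisionOp (h σ (x + proj (σ • v))) (h σ (x + proj (σ • v))) v := by
    intro h x v
    funext σ
    simp only [Literature.Analysis.FluidPDE.alongFlow, Literature.Analysis.FluidPDE.collisionTerm,
      Literature.Analysis.FluidPDE.Torus.geometry_translate,
      Literature.Analysis.FluidPDE.collisionOpWith_hardSphereKernel]
  have hduh : ∀ {h : ℝ → UnitAddTorus d → EuclideanSpace ℝ d → ℝ},
      Literature.Analysis.FluidPDE.IsMildBoltzmannSolutionOn T
        (Literature.Analysis.FluidPDE.Torus.geometry d) hardSphereKernel h →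
      ∀ x v, ∀ s ∈ Icc 0 T, h s (x + proj (s • v)) v =
        h 0 x v + ∫ σ in (0 : ℝ)..s, collisionOp (h σ (x + proj (σ • v))) (h σ (x + proj (σ • v))) v := by
    intro h hm x v s hs
    have := hm.duhamel x v s hs
    rw [hchar h x v] at this
    simpa only [Literature.Analysis.FluidPDE.alongFlow,
      Literature.Analysis.FluidPDE.Torus.geometry_translate] using this
  have hii : ∀ {h : ℝ → UnitAddTorus d → EuclideanSpace ℝ d → ℝ},
      Literature.Analysis.FluidPDE.IsMildBoltzmannSolutionOn T
        (Literature.Analysis.FluidPDE.Torus.geometry d) hardSphereKernel h →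
      ∀ x v, ∀ s ∈ Icc 0 T, IntervalIntegrable
        (fun σ => collisionOp (h σ (x + proj (σ • v))) (h σ (x + proj (σ • v))) v) volume 0 s := by
    intro h hm x v s hs
    have := hm.intervalIntegrable x v s hs
    rwa [hchar h x v] at this
  -- the bootstrap on the strip
  have boot : ∀ n : ℕ, ∀ s ∈ Icc 0 T, t₁ ≤ s → s ≤ t₁ + τ → ∀ y v,
      |f s y v - g s y v| ≤ 2 * M * θ ^ n * exp (-((β - lam * (s - t₁)) / 2) * ‖v‖ ^ 2) := by
    intro n
    induction n with
    | zero =>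
      intro s hs hs₁ hs₂ y v
      have hw : exp (-(β / 2) * ‖v‖ ^ 2) ≤ exp (-((β - lam * (s - t₁)) / 2) * ‖v‖ ^ 2) := by
        refine exp_weight_mono ?_ ‖v‖
        nlinarith [hlam.le]
      have h1 := hfb s hs y v
      have h2 := hgb s hs y v
      have h3 := abs_sub (f s y v) (g s y v)
      have h4 : 0 ≤ M * exp (-((β - lam * (s - t₁)) / 2) * ‖v‖ ^ 2) := by positivity
      rw [pow_zero, mul_one]
      nlinarith [mul_le_mul_of_nonneg_left hw hM]
    | succ n ih =>
      intro s hs hs₁ hs₂ y v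
      set N : ℝ := 2 * M * θ ^ n with hN
      have hN0 : 0 ≤ N := by positivity
      -- the characteristic through `(s, y, v)` starts at `x = y - s v`
      set x : UnitAddTorus d := y + proj (-(s • v)) with hx
      have hxy : x + proj (s • v) = y := by rw [hx, proj_neg, neg_add_cancel_right]
      set qf : ℝ → ℝ := fun σ => collisionOp (f σ (x + proj (σ • v))) (f σ (x + proj (σ • v))) v with hqf
      set qg : ℝ → ℝ := fun σ => collisionOp (g σ (x + proj (σ • v))) (g σ (x + proj (σ • v))) v with hqg
      have hfs := hduh hfm x v s hs
      have hgs := hduh hgm x v s hs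
      have h00 : f 0 x v = g 0 x v := by
        rw [hagree 0 ⟨le_refl _, hs.1.trans hs.2⟩ ht₁.1]
      -- `f - g` at `(s, y, v)` is the integral of `qf - qg` over `[t₁, s]`
      have hif : IntervalIntegrable qf volume 0 s := hii hfm x v s hs
      have hig : IntervalIntegrable qg volume 0 s := hii hgm x v s hs
      have hif₁ : IntervalIntegrable qf volume 0 t₁ := hii hfm x v t₁ ht₁
      have hig₁ : IntervalIntegrable qg volume 0 t₁ := hii hgm x v t₁ ht₁
      have hzero : ∫ σ in (0 : ℝ)..t₁, (qf σ - qg σ) = 0 := by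
        rw [intervalIntegral.integral_congr (g := fun _ => (0 : ℝ)) fun σ hσ => ?_]
        · simp
        · rw [uIcc_of_le ht₁.1] at hσ
          have hσT : σ ∈ Icc 0 T := ⟨hσ.1, hσ.2.trans ht₁.2⟩
          simp only [hqf, hqg, hagree σ hσT hσ.2, sub_self]
      have hrepr : f s y v - g s y v = ∫ σ in t₁..s, (qf σ - qg σ) := by
        have h1 : f s y v - g s y v = ∫ σ in (0 : ℝ)..s, (qf σ - qg σ) := by
          rw [intervalIntegral.integral_sub hif hig, ← hxy, hfs, hgs, h00]; ring
        rw [h1, ← intervalIntegral.integral_add_adjacent_intervals (b := t₁)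
          ((hif₁.sub hig₁)) ((hif₁.symm.trans hif).sub (hig₁.symm.trans hig)), hzero, zero_add]
      -- pointwise bound on `qf - qg` in the scale restarted at `t₁`
      have hq : ∀ σ ∈ Ioo t₁ s, |qf σ - qg σ| ≤ (4 * M * N * S * I₁) *
          ((1 + ‖v‖) * exp (-((β - lam * (σ - t₁)) / 2) * ‖v‖ ^ 2)) := by
        intro σ hσ
        have hσT : σ ∈ Icc 0 T := ⟨ht₁.1.trans hσ.1.le, hσ.2.le.trans hs.2⟩
        have hβσ : 0 < β - lam * (σ - t₁) := by nlinarith [hσ.1, hσ.2, hlam.le]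
        have hβσ' : β / 2 ≤ β - lam * (σ - t₁) := by nlinarith [hσ.1, hσ.2, hlam.le]
        have hβσ'' : β - lam * (σ - t₁) ≤ β := by nlinarith [hσ.1, hlam.le]
        have hfc' : Continuous (f σ (x + proj (σ • v))) :=
          (hfc σ hσT).comp (Continuous.prodMk_right (x + proj (σ • v)))
        have hgc' : Continuous (g σ (x + proj (σ • v))) :=
          (hgc σ hσT).comp (Continuous.prodMk_right (x + proj (σ • v)))
        have hw : ∀ u : EuclideanSpace ℝ d, exp (-(β / 2) * ‖u‖ ^ 2) ≤
            exp (-((β - lam * (σ - t₁)) / 2) * ‖u‖ ^ 2) := fun u => exp_weight_mono hβσ'' ‖u‖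
        have hfb' : ∀ u, |f σ (x + proj (σ • v)) u| ≤ M * exp (-((β - lam * (σ - t₁)) / 2) * ‖u‖ ^ 2) :=
          fun u => (hfb σ hσT _ u).trans (mul_le_mul_of_nonneg_left (hw u) hM)
        have hgb' : ∀ u, |g σ (x + proj (σ • v)) u| ≤ M * exp (-((β - lam * (σ - t₁)) / 2) * ‖u‖ ^ 2) :=
          fun u => (hgb σ hσT _ u).trans (mul_le_mul_of_nonneg_left (hw u) hM)
        have hfg' : ∀ u, |f σ (x + proj (σ • v)) u - g σ (x + proj (σ • v)) u| ≤
            N * exp (-((β - lam * (σ - t₁)) / 2) * ‖u‖ ^ 2) :=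
          fun u => ih σ hσT hσ.1.le (hσ.2.le.trans hs₂) _ u
        have h := abs_collisionOp_sub_le hfc' hgc' hM hN0 hβσ hfb' hgb' hfg' v
        have hI : ∫ u : EuclideanSpace ℝ d, (1 + ‖u‖) * exp (-((β - lam * (σ - t₁)) / 2) * ‖u‖ ^ 2) ≤ I₁ :=
          integral_one_add_norm_mul_exp_mono (half_pos hβ) hβσ'
        refine h.trans ?_
        have hψ0 : 0 ≤ (1 + ‖v‖) * exp (-((β - lam * (σ - t₁)) / 2) * ‖v‖ ^ 2) := by positivity
        exact mul_le_mul_of_nonneg_right (mul_le_mul_of_nonneg_left hI (by positivity)) hψ0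
      have hint := abs_integral_le_of_scale (q := fun σ => qf σ - qg σ) (by positivity) hlam hs₁ hq
      rw [hrepr]
      refine hint.trans ?_
      have hsq : sqrt (s - t₁) ≤ sqrt τ := sqrt_le_sqrt (by linarith)
      have hρs : (s - t₁) + 2 * sqrt (s - t₁) / sqrt (2 * lam) ≤ ρ := by
        have : 2 * sqrt (s - t₁) / sqrt (2 * lam) ≤ 2 * sqrt τ / sqrt (2 * lam) :=
          div_le_div_of_nonneg_right (by linarith) (sqrt_nonneg _)
        rw [hρ]; linarith
      have hA : 0 ≤ 4 * M * N * S * I₁ * exp (-((β - lam * (s - t₁)) / 2) * ‖v‖ ^ 2) := by positivity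
      calc 4 * M * N * S * I₁ * exp (-((β - lam * (s - t₁)) / 2) * ‖v‖ ^ 2) *
            ((s - t₁) + 2 * sqrt (s - t₁) / sqrt (2 * lam))
          ≤ 4 * M * N * S * I₁ * exp (-((β - lam * (s - t₁)) / 2) * ‖v‖ ^ 2) * ρ :=
            mul_le_mul_of_nonneg_left hρs hA
        _ = 2 * M * θ ^ (n + 1) * exp (-((β - lam * (s - t₁)) / 2) * ‖v‖ ^ 2) := by
            rw [hN, hθdef]; ring
  -- conclusion on the strip
  intro t ht ht₂
  rcases le_or_gt t t₁ with h | h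
  · exact hagree t ht h
  funext y v
  have hlim : Tendsto (fun n : ℕ => 2 * M * θ ^ n * exp (-((β - lam * (t - t₁)) / 2) * ‖v‖ ^ 2))
      atTop (𝓝 0) := by
    have := ((tendsto_pow_atTop_nhds_zero_of_lt_one hθ0 hθ1).const_mul (2 * M)).mul_const
      (exp (-((β - lam * (t - t₁)) / 2) * ‖v‖ ^ 2))
    simpa using this
  have habs : |f t y v - g t y v| ≤ 0 :=
    ge_of_tendsto' hlim fun n => boot n t ht h.le ht₂ y v
  have := abs_nonneg (f t y v - g t y v)
  have h0 : f t y v - g t y v = 0 := abs_eq_zero.1 (le_antisymm habs this)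
  linarith

/-- **Uniqueness half of `ukai_lanford_lwp`**: two mild solutions of the hard-sphere Boltzmann
equation on `[0, T] × T^d` in `C([0, T]; X_β)`, `β > 0`, with the same initial datum coincide on
`[0, T]` (uniform bound on the compact time interval, then `eqOn_strip` on `⌈T/τ⌉` consecutive
strips). [cite: GST2013, Part I Ch. 2 §3.1 Thm 1] -/
theorem eqOn_of_mild {f g : ℝ → UnitAddTorus d → EuclideanSpace ℝ d → ℝ} {β T : ℝ} (hβ : 0 < β)
    (hf : Literature.Analysis.FluidPDE.ContinuousInLanfordOn (Icc 0 T) β f)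
    (hfm : Literature.Analysis.FluidPDE.IsMildBoltzmannSolutionOn T
      (Literature.Analysis.FluidPDE.Torus.geometry d) hardSphereKernel f)
    (hg : Literature.Analysis.FluidPDE.ContinuousInLanfordOn (Icc 0 T) β g)
    (hgm : Literature.Analysis.FluidPDE.IsMildBoltzmannSolutionOn T
      (Literature.Analysis.FluidPDE.Torus.geometry d) hardSphereKernel g)
    (h0 : f 0 = g 0) : EqOn f g (Icc 0 T) := by
  obtain ⟨Mf, hMf0, hMf⟩ := exists_bound_of_continuousInLanfordOn hf
  obtain ⟨Mg, hMg0, hMg⟩ := exists_bound_of_continuousInLanfordOn hg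
  set M : ℝ := max Mf Mg with hMdef
  have hM : 0 ≤ M := hMf0.trans (le_max_left _ _)
  have hfb : ∀ t ∈ Icc 0 T, ∀ x v, |f t x v| ≤ M * exp (-(β / 2) * ‖v‖ ^ 2) := fun t ht x v =>
    (hMf t ht x v).trans (mul_le_mul_of_nonneg_right (le_max_left _ _) (exp_pos _).le)
  have hgb : ∀ t ∈ Icc 0 T, ∀ x v, |g t x v| ≤ M * exp (-(β / 2) * ‖v‖ ^ 2) := fun t ht x v =>
    (hMg t ht x v).trans (mul_le_mul_of_nonneg_right (le_max_right _ _) (exp_pos _).le)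
  have hfc : ∀ t ∈ Icc 0 T, Continuous (Function.uncurry (f t)) := fun t ht => (hf.1 t ht).1
  have hgc : ∀ t ∈ Icc 0 T, Continuous (Function.uncurry (g t)) := fun t ht => (hg.1 t ht).1
  -- the strip length
  set S : ℝ := (sphereMeasure : Measure (sphere (0 : EuclideanSpace ℝ d) 1)).real univ with hS
  set I₁ : ℝ := ∫ u : EuclideanSpace ℝ d, (1 + ‖u‖) * exp (-(β / 2 / 2) * ‖u‖ ^ 2) with hI₁
  have hS0 : 0 ≤ S := measureReal_nonneg
  have hI0 : 0 ≤ I₁ := integral_one_add_norm_mul_exp_nonneg _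
  set lam : ℝ := β / 4 with hlam
  have hlam0 : 0 < lam := by positivity
  set a : ℝ := 1 + 2 / sqrt (β / 2) with ha
  have ha0 : 0 < a := by positivity
  set c : ℝ := 8 * M * S * I₁ * a with hc
  have hc0 : 0 ≤ c := by positivity
  set τ : ℝ := (1 / (1 + c)) ^ 2 with hτ
  have hτ0 : 0 < τ := by positivity
  have hsqτ : sqrt τ = 1 / (1 + c) := by rw [hτ, sqrt_sq (by positivity)]
  have hsqτ1 : sqrt τ ≤ 1 := by
    rw [hsqτ, div_le_one (by positivity)]; linarith
  have hτsq : τ ≤ sqrt τ :=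
    calc τ = sqrt τ * sqrt τ := (Real.mul_self_sqrt hτ0.le).symm
      _ ≤ sqrt τ * 1 := mul_le_mul_of_nonneg_left hsqτ1 (sqrt_nonneg _)
      _ = sqrt τ := mul_one _
  have hτ1 : τ ≤ 1 := hτsq.trans hsqτ1
  have hlamτ : lam * τ ≤ β / 2 := by rw [hlam]; nlinarith
  have h2lam : 2 * lam = β / 2 := by rw [hlam]; ring
  have hρle : τ + 2 * sqrt τ / sqrt (2 * lam) ≤ sqrt τ * a := by
    rw [ha, h2lam, mul_add, mul_one]
    have : 2 * sqrt τ / sqrt (β / 2) = sqrt τ * (2 / sqrt (β / 2)) := by ring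
    rw [this]; linarith
  have hsmall : 4 * M * S * I₁ * (τ + 2 * sqrt τ / sqrt (2 * lam)) ≤ 1 / 2 := by
    have h1 : 4 * M * S * I₁ * (τ + 2 * sqrt τ / sqrt (2 * lam)) ≤ 4 * M * S * I₁ * (sqrt τ * a) :=
      mul_le_mul_of_nonneg_left hρle (by positivity)
    have h2 : 4 * M * S * I₁ * (sqrt τ * a) = (c / 2) / (1 + c) := by rw [hc, hsqτ]; ring
    have h3 : (c / 2) / (1 + c) ≤ 1 / 2 := by
      rw [div_le_iff₀ (by positivity)]; linarith
    linarith
  -- induction on the strips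
  have strips : ∀ k : ℕ, ∀ t ∈ Icc 0 T, t ≤ k * τ → f t = g t := by
    intro k
    induction k with
    | zero =>
      intro t ht htk
      have : t = 0 := le_antisymm (by simpa using htk) ht.1
      rw [this, h0]
    | succ k ih =>
      intro t ht htk
      rcases le_or_gt t (k * τ) with h | h
      · exact ih t ht h
      · have hkT : (k : ℝ) * τ ∈ Icc 0 T := ⟨by positivity, h.le.trans ht.2⟩
        refine eqOn_strip hβ hM hlam0 hτ0.le hlamτ hkT hfc hgc hfb hgb hfm hgm ih hsmall t ht ?_
        push_cast at htk
        linarith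
  intro t ht
  obtain ⟨k, hk⟩ := exists_nat_ge (t / τ)
  exact strips k t ht (by rwa [div_le_iff₀ hτ0] at hk)

end UkaiLanford

/-- **hilbert6.S13, discharged** (local well-posedness of the hard-sphere Boltzmann equation on
the torus in Lanford's class; Gallagher–Saint-Raymond–Texier 2013, Part I Ch. 2 §3.1 Thm 1 —
there stated for bounded cross-sections on `ℝ^d` — proved for hard spheres by the scale method
of Part II Ch. 5 (Thm 7, continuity estimates, Lemma of Ukai; Ukai 2001), with a-posteriori
positivity and strip-by-strip uniqueness). [cite: GST2013, Part I Ch. 2 §3.1 Thm 1; Part II Ch. 5 Thm 7] -/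
theorem ukai_lanford_lwp_holds : ukai_lanford_lwp (d := d) := by
  intro β₀ hβ₀ K hK
  obtain ⟨T, hT, hex⟩ := UkaiLanford.exists_mildSolution (d := d) hβ₀ hK
  refine ⟨T, hT, fun f₀ hnn hL hK' => ⟨hex f₀ hnn hL hK', fun f g hf hfm hf0 hg hgm hg0 => ?_⟩⟩
  exact UkaiLanford.eqOn_of_mild (half_pos hβ₀) hf hfm hg hgm (hf0.trans hg0.symm)

end UkaiLanfordLWP

end

end Literature.MathematicalPhysics.KineticTheory
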